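import Literature.NumberTheory.LFunctions.WeilWindowSuzuki
import Literature.NumberTheory.LFunctions.WeilMarkovQuadratic
import Literature.NumberTheory.LFunctions.WeilSmallSupportPositivity
import Mathlib.Analysis.SpecialFunctions.SmoothTransition
import Mathlib.Analysis.SpecialFunctions.Integrals.Basic
import HarnessLib

/-!
# Small windows of Weil's quadratic form: proof of Suzuki's Theorem 1.4 (variational form)

Sibling proof file of `Literature/NumberTheory/LFunctions/WeilWindowSuzuki.lean`. It DISCHARGES the
claim `Literature.NumberTheory.LFunctions.Suzuki2026_thm_1_4` (M. Suzuki, *Weil's quadratic form via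
the screw function*, arXiv:2606.09096 (2026), Theorem 1.4, p. 4: "For sufficiently small `a > 0`, the
lowest eigenvalue `λ_a` is positive, simple […]. Furthermore, the corresponding eigenfunction is
even."), in the tree's variational rendering

  `∃ a₀ > 0, ∀ a ∈ (0, a₀], 0 < ε(a) ∧ WeilWindowSimpleEven a`,

`ε(a) = weilGroundEnergy a`, where `WeilWindowSimpleEven a` asks for a witness `φ` and a gap `δ > 0`
such that every `L²`-normalised test function `g` on `[-a, a]` which is odd, or even and
`L²`-orthogonal to `φ`, has `Re Q(g) ≥ ε(a) + δ`.

## The proof (same normalisation as the sibling files)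

Suzuki's printed proof (§5, pp. 14–15) rescales the window to `(-1, 1)`, writes the Rayleigh
quotient as `log(1/a) − (2A+1) + 𝓛(v)/‖v‖² + O(a)` with the scale-free jump form
`𝓛(v) = ¼ ∬ |v(x) − v(y)|²/|x−y| − ½ ∫ |v|² log(1 − x²)` ((4.4)), and obtains simplicity and
evenness of the bottom from the theory of irreducible Dirichlet forms (Beurling–Deny, positivity
improving semigroup) and Kato perturbation theory. None of that operator theory is available in
Mathlib, and none of it is needed for the variational statement above: we give a direct,
quantitative argument in the tree's normalisation, built on the **Markov decomposition** of the
form already proved in `WeilMarkovQuadratic.lean`,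

  `Re Q(g) = P(g) + 𝓔_a(g) − M_a ‖g‖₂²`   (`weilQuadratic_re_eq_weilPoleForm_add_weilDirichletEnergy_sub`),

`𝓔_a(g) = Σ_{log n < 2a} Λ(n) n^{-1/2} D_{log n}(g) + ∫₀^∞ w(t) D_t(g) dt`, `D_t(g) = ∫ |g(x+t) − g(x)|² dx`
(`weilIncrement`), `w(t) = e^{t/2}/(2 sinh t)` (`weilArchDensity`), `P` the pole form. This is
exactly the jump-form structure behind Suzuki's `𝓛` (his (4.4)–(4.5) are the rescaled versions of
the identities below), used WITHOUT passing to the limit `a → 0`.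

* **Witness.** Take `φ := 1`. An odd `g`, and an even `g` with `∫ conj 1 · g = 0`, both have
  `∫ g = 0`; so it suffices to produce a uniform gap for MEAN-ZERO normalised test functions.
* **Splitting at `2a`.** For `tsupport g ⊆ [-a, a]` one has `D_t(g) = 2‖g‖₂²` for `t ≥ 2a`
  (`weilIncrement_eq_of_le_abs`) and, for `2a ≤ log 2`, no prime enters; hence
  `𝓔_a(g) = A(g) + 2‖g‖₂² T(a)` with `A(g) = ∫_{(0,2a]} w D_t(g) dt` and `T(a) = ∫_{2a}^∞ w`
  (`weilDirichletEnergy_eq_of_two_mul_le_log_two`). The constants `T(a)` and `M_a` are the same for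
  all normalised `g` and cancel in the gap.
* **Lower bound for mean-zero `g` (bathtub).** `∫₀^{2a} D_t(g) dt = 4a‖g‖₂² − |∫ g|²`
  (`intervalIntegral_weilIncrement`; the kernel `k = g ⋆ g̃` has `k(t) + k(−t) = 2‖g‖² − D_t(g)` and
  `∫ k = |∫ g|²`), `0 ≤ D_t ≤ 4‖g‖₂²`, and `w` is decreasing; so for `‖g‖₂ = 1`, `∫ g = 0` the
  bathtub principle gives `A(g) ≥ 4 ∫_a^{2a} w ≥ 2 e^{-a} log 2 ≈ 1.37` (`setIntegral_Ioc_bathtub`,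
  `gap_lower_bound`).
* **Upper bound for `ε(a)` (trial function).** A smooth even plateau `B` (`= 1` on `[-9a/10, 9a/10]`,
  supported in `[-a, a]`, values in `[0,1]`, non-increasing in `|x|`; built from
  `Real.smoothTransition`) has `D_t(B) ≤ ∫ |B(x+t) − B(x)| dx = 2 ∫_{(-t/2, t/2]} B ≤ 2t`
  (`integral_abs_sub_le_of_plateau`), whence `A(B)/‖B‖₂² ≤ 2a e^{a}/(9a/5) ≈ 1.12`, and
  `P(B)/‖B‖₂² = O(a)`; so `ε(a) ≤ Re Q(B)/‖B‖₂²`.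
* **Pole form.** `P(g) ≥ −2(sinh a − a)` (`Yoshida1992_polar_lower_bound`).
* Altogether `Re Q(g) − ε(a) ≥ 2e^{-a} log 2 − (10/9) e^{a} − O(a) ≥ 1/10` for `0 < a ≤ 1/100`
  (`weilGroundEnergy_add_le_of_integral_eq_zero`), i.e. `WeilWindowSimpleEven a` with `φ = 1`,
  `δ = 1/10`.
* **Positivity** `ε(a) > 0` for small `a` is Bombieri's Theorem 12 / Yoshida, in the tree as
  `weilQuadratic_coercive` (`WeilSmallSupportPositivity.lean`): `Re Q(g) ≥ ‖g‖₂²` on small windows.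

By min–max this variational gap is exactly "the bottom of the spectrum of `A_a` is a simple isolated
eigenvalue whose eigenfunction is even (and not orthogonal to the constants)" — Suzuki's Theorem 1.4
without the asymptotic expansion, which is the separate claim `Suzuki2026_thm_1_4_asymptotic` and is
NOT proved here. Everything in this file is proved; no named facts, no new definitions.

## References

* M. Suzuki, *Weil's quadratic form via the screw function*, arXiv:2606.09096 (2026), Thm. 1.4 (p. 4),
  §4.2 eqs. (4.4)–(4.5), §5 (pp. 14–15).
* E. Bombieri, *Remarks on Weil's quadratic functional in the theory of prime numbers I*, Rend. Mat.
  Acc. Lincei (9) 11 (2000), Thm. 2 and Thm. 12.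
* H. Yoshida, *On Hermitian forms attached to zeta functions*, Adv. Stud. Pure Math. 21 (1992), §6.
* E. H. Lieb, M. Loss, *Analysis*, 2nd ed., AMS (2001), Thm. 1.14 (bathtub principle).
-/

noncomputable section

open Complex Filter Set MeasureTheory
open scoped Real Topology ComplexConjugate ArithmeticFunction.vonMangoldt ContDiff

namespace Literature.NumberTheory.LFunctions

variable {g : ℝ → ℂ}

/-! ## The increment form `D_t(g)`: size, support, continuity -/

/-- `Re k(t) + Re k(−t) = 2‖g‖₂² − D_t(g)` for `k = g ⋆ g̃` (real part of
`weilConv_weilReflect_add_neg`). [folklore] -/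
theorem re_weilConv_weilReflect_add_re_neg (hg : IsWeilTest g) (t : ℝ) :
    (weilConv g (weilReflect g) t).re + (weilConv g (weilReflect g) (-t)).re =
      2 * (∫ x : ℝ, ‖g x‖ ^ 2) - weilIncrement g t := by
  have h := congrArg Complex.re (weilConv_weilReflect_add_neg hg t)
  rwa [Complex.add_re, Complex.ofReal_re] at h

/-- `D_t(g) = 2‖g‖₂² − (Re k(t) + Re k(−t))`, `k = g ⋆ g̃`. [folklore] -/
theorem weilIncrement_eq_sub_re (hg : IsWeilTest g) (t : ℝ) :
    weilIncrement g t = 2 * (∫ x : ℝ, ‖g x‖ ^ 2) -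
      ((weilConv g (weilReflect g) t).re + (weilConv g (weilReflect g) (-t)).re) := by
  rw [re_weilConv_weilReflect_add_re_neg hg]
  ring

/-- `t ↦ D_t(g)` is continuous for a test function `g` (it is `2‖g‖₂² − Re k(t) − Re k(−t)` with
`k = g ⋆ g̃` smooth). [folklore] -/
theorem continuous_weilIncrement (hg : IsWeilTest g) : Continuous (weilIncrement g) := by
  have hk : Continuous (weilConv g (weilReflect g)) := (hg.weilConv hg.weilReflect).1.continuous
  have heq : weilIncrement g = fun t ↦ 2 * (∫ x : ℝ, ‖g x‖ ^ 2) -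
      ((weilConv g (weilReflect g) t).re + (weilConv g (weilReflect g) (-t)).re) :=
    funext (weilIncrement_eq_sub_re hg)
  rw [heq]
  exact continuous_const.sub ((Complex.continuous_re.comp hk).add
    (Complex.continuous_re.comp (hk.comp continuous_neg)))

/-- `D_t(g) ≤ 4‖g‖₂²` (`|u − v|² ≤ 2|u|² + 2|v|²` and translation invariance). [folklore] -/
theorem weilIncrement_le (hg : IsWeilTest g) (t : ℝ) :
    weilIncrement g t ≤ 4 * ∫ x : ℝ, ‖g x‖ ^ 2 := by
  have h2 : Integrable fun u : ℝ ↦ ‖g u‖ ^ 2 := hg.integrable_norm_sq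
  have h2' : Integrable fun u : ℝ ↦ ‖g (u + t)‖ ^ 2 := h2.comp_add_right t
  unfold weilIncrement
  calc ∫ x : ℝ, ‖g (x + t) - g x‖ ^ 2
      ≤ ∫ x : ℝ, (2 * ‖g (x + t)‖ ^ 2 + 2 * ‖g x‖ ^ 2) := by
        refine integral_mono_of_nonneg (Eventually.of_forall fun _ ↦ by positivity)
          ((h2'.const_mul 2).add (h2.const_mul 2)) (Eventually.of_forall fun x ↦ ?_)
        have h := norm_sub_le (g (x + t)) (g x)
        have h' := mul_self_le_mul_self (norm_nonneg _) h
        nlinarith [h', sq_nonneg (‖g (x + t)‖ - ‖g x‖)]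
    _ = 4 * ∫ x : ℝ, ‖g x‖ ^ 2 := by
        rw [integral_add (h2'.const_mul 2) (h2.const_mul 2), integral_const_mul,
          integral_const_mul, integral_add_right_eq_self (fun u : ℝ ↦ ‖g u‖ ^ 2) t]
        ring

/-- **Beyond the window the increment is constant**: for `tsupport g ⊆ [-a, a]` and `|t| ≥ 2a`,
`D_t(g) = 2‖g‖₂²` (the translate and `g` have disjoint supports; equivalently `k(±t) = 0` for
`k = g ⋆ g̃`, `weilConv_weilReflect_eq_zero_of_le_abs`). [folklore] -/
theorem weilIncrement_eq_of_le_abs (hg : IsWeilTest g) {a : ℝ} (hsupp : tsupport g ⊆ Icc (-a) a)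
    {t : ℝ} (ht : 2 * a ≤ |t|) : weilIncrement g t = 2 * ∫ x : ℝ, ‖g x‖ ^ 2 := by
  rw [weilIncrement_eq_sub_re hg, weilConv_weilReflect_eq_zero_of_le_abs hg hsupp ht,
    weilConv_weilReflect_eq_zero_of_le_abs hg hsupp (by rwa [abs_neg]), Complex.zero_re]
  ring

/-! ## `∫ k = |∫ g|²` and `∫₀^{2a} D_t(g) dt = 4a‖g‖₂² − |∫ g|²` -/

/-- `∫ (g ⋆ g̃) = |∫ g|²`: it is `k̂(1/2) = |ĝ(1/2)|²` (`weilMellin_weilQuadratic_of_re_eq`) and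
`ĝ(1/2) = ∫ g`. [folklore] -/
theorem integral_weilConv_weilReflect (hg : IsWeilTest g) :
    ∫ t : ℝ, weilConv g (weilReflect g) t = ((‖∫ x : ℝ, g x‖ ^ 2 : ℝ) : ℂ) := by
  have h1 : ∫ t : ℝ, weilConv g (weilReflect g) t =
      weilMellin (weilConv g (weilReflect g)) (1 / 2) := by
    unfold weilMellin
    congr 1 with t
    simp
  have h2 : weilMellin g (1 / 2) = ∫ x : ℝ, g x := by
    unfold weilMellin
    congr 1 with t
    simp
  have hre : ((1 : ℂ) / 2).re = 1 / 2 := by norm_num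
  rw [h1, weilMellin_weilQuadratic_of_re_eq hg hre, Complex.normSq_eq_norm_sq, h2]

/-- On the symmetric interval `[-2a, 2a] ⊇ tsupport k`: `∫_{-2a}^{2a} k = |∫ g|²`. [folklore] -/
theorem intervalIntegral_weilConv_weilReflect (hg : IsWeilTest g) {a : ℝ} (ha : 0 ≤ a)
    (hsupp : tsupport g ⊆ Icc (-a) a) :
    ∫ t in (-(2 * a))..(2 * a), weilConv g (weilReflect g) t = ((‖∫ x : ℝ, g x‖ ^ 2 : ℝ) : ℂ) := by
  rw [intervalIntegral.integral_of_le (by linarith), ← integral_weilConv_weilReflect hg]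
  refine setIntegral_eq_integral_of_forall_compl_eq_zero fun t ht ↦ ?_
  apply weilConv_weilReflect_eq_zero_of_le_abs hg hsupp
  by_contra hlt
  rw [not_le] at hlt
  have h := abs_lt.1 hlt
  exact ht ⟨h.1, h.2.le⟩

/-- **Mass of the increments on `(0, 2a]`**: for a test function `g` with `tsupport g ⊆ [-a, a]`,
`∫₀^{2a} D_t(g) dt = 4a ‖g‖₂² − |∫ g|²`. Proof: `D` is even, so `∫₀^{2a} D = ½ ∫_{-2a}^{2a} D`, and
`D_t = 2‖g‖₂² − Re k(t) − Re k(−t)` with `∫_{-2a}^{2a} Re k(±t) dt = Re ∫ k = |∫ g|²`. This is the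
finite-window form of the mean-zero constraint used for Suzuki's scale-free form `𝓛`. [folklore] -/
theorem intervalIntegral_weilIncrement (hg : IsWeilTest g) {a : ℝ} (ha : 0 ≤ a)
    (hsupp : tsupport g ⊆ Icc (-a) a) :
    ∫ t in (0 : ℝ)..(2 * a), weilIncrement g t =
      4 * a * (∫ x : ℝ, ‖g x‖ ^ 2) - ‖∫ x : ℝ, g x‖ ^ 2 := by
  set k : ℝ → ℂ := weilConv g (weilReflect g) with hk
  set N : ℝ := ∫ x : ℝ, ‖g x‖ ^ 2 with hN
  have hkc : Continuous k := (hg.weilConv hg.weilReflect).1.continuous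
  have hDc : Continuous (weilIncrement g) := continuous_weilIncrement hg
  have hrc : Continuous fun t ↦ (k t).re := Complex.continuous_re.comp hkc
  have hrc' : Continuous fun t ↦ (k (-t)).re := Complex.continuous_re.comp (hkc.comp continuous_neg)
  have hsum : Continuous fun t ↦ (k t).re + (k (-t)).re := hrc.add hrc'
  -- evenness of `D`
  have hsymm : ∫ t in (-(2 * a))..0, weilIncrement g t = ∫ t in (0 : ℝ)..(2 * a), weilIncrement g t := by
    have h : ∫ t in (0 : ℝ)..(2 * a), weilIncrement g (-t) = ∫ t in (-(2 * a))..(-0), weilIncrement g t :=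
      intervalIntegral.integral_comp_neg (weilIncrement g)
    simp only [weilIncrement_neg, neg_zero] at h
    exact h.symm
  have hsplit : ∫ t in (-(2 * a))..(2 * a), weilIncrement g t =
      2 * ∫ t in (0 : ℝ)..(2 * a), weilIncrement g t := by
    rw [← intervalIntegral.integral_add_adjacent_intervals (b := 0)
      (hDc.intervalIntegrable _ _) (hDc.intervalIntegrable _ _), hsymm]
    ring
  -- the real parts of `k`
  have hkre : ∫ t in (-(2 * a))..(2 * a), (k t).re = ‖∫ x : ℝ, g x‖ ^ 2 := by
    have h := Complex.reCLM.intervalIntegral_comp_comm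
      (hkc.intervalIntegrable (μ := volume) (-(2 * a)) (2 * a))
    simp only [Complex.reCLM_apply] at h
    rw [h, hk, intervalIntegral_weilConv_weilReflect hg ha hsupp, Complex.ofReal_re]
  have hkre' : ∫ t in (-(2 * a))..(2 * a), (k (-t)).re = ‖∫ x : ℝ, g x‖ ^ 2 := by
    have h : ∫ t in (-(2 * a))..(2 * a), (k (-t)).re = ∫ t in (-(2 * a))..(-(-(2 * a))), (k t).re :=
      intervalIntegral.integral_comp_neg (fun t ↦ (k t).re)
    rw [neg_neg] at h
    rw [h, hkre]
  have hall : ∫ t in (-(2 * a))..(2 * a), weilIncrement g t =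
      8 * a * N - 2 * ‖∫ x : ℝ, g x‖ ^ 2 := by
    have heq : (fun t ↦ weilIncrement g t) = fun t ↦ 2 * N - ((k t).re + (k (-t)).re) :=
      funext (weilIncrement_eq_sub_re hg)
    rw [heq, intervalIntegral.integral_sub intervalIntegrable_const
      (hsum.intervalIntegrable _ _), intervalIntegral.integral_const,
      intervalIntegral.integral_add (hrc.intervalIntegrable _ _) (hrc'.intervalIntegrable _ _),
      hkre, hkre', smul_eq_mul]
    ring
  linarith [hsplit, hall]

/-! ## The bathtub principle on `(0, 2a]` -/

/-- **Bathtub principle** (Lieb–Loss, Thm. 1.14, the case needed here): on `(0, 2a]` let `w` be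
non-increasing and `0 ≤ D ≤ M` with `∫_{(0,2a]} D ≥ M a`. Then `∫_{(0,2a]} w D ≥ M ∫_{(a,2a]} w`
(the mass of `D` sits where `w` is smallest in the extremal case `D = M · 1_{(a,2a]}`). Proof:
on `(0,a]`, `wD ≥ w(a) D`; on `(a, 2a]`, `wD ≥ M w + w(a)(D − M)`; add. [cite: LiebLoss2001, Thm. 1.14] -/
theorem setIntegral_Ioc_bathtub {w D : ℝ → ℝ} {a M : ℝ} (ha : 0 ≤ a)
    (hw : ∀ ⦃s t : ℝ⦄, 0 < s → s ≤ t → t ≤ 2 * a → w t ≤ w s) (hwa : 0 ≤ w a)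
    (hD0 : ∀ t ∈ Ioc 0 (2 * a), 0 ≤ D t) (hDM : ∀ t ∈ Ioc 0 (2 * a), D t ≤ M)
    (hDi : IntegrableOn D (Ioc 0 (2 * a))) (hwDi : IntegrableOn (fun t ↦ w t * D t) (Ioc 0 (2 * a)))
    (hwi : IntegrableOn w (Ioc a (2 * a))) (hmass : M * a ≤ ∫ t in Ioc 0 (2 * a), D t) :
    M * ∫ t in Ioc a (2 * a), w t ≤ ∫ t in Ioc 0 (2 * a), w t * D t := by
  have hdisj : Disjoint (Ioc 0 a) (Ioc a (2 * a)) := Ioc_disjoint_Ioc_of_le le_rfl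
  have hunion : Ioc 0 a ∪ Ioc a (2 * a) = Ioc 0 (2 * a) := Ioc_union_Ioc_eq_Ioc ha (by linarith)
  have hsub1 : Ioc 0 a ⊆ Ioc 0 (2 * a) := Ioc_subset_Ioc_right (by linarith)
  have hsub2 : Ioc a (2 * a) ⊆ Ioc 0 (2 * a) := Ioc_subset_Ioc_left ha
  have hDi1 : IntegrableOn D (Ioc 0 a) := hDi.mono_set hsub1
  have hDi2 : IntegrableOn D (Ioc a (2 * a)) := hDi.mono_set hsub2
  have hwDi1 : IntegrableOn (fun t ↦ w t * D t) (Ioc 0 a) := hwDi.mono_set hsub1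
  have hwDi2 : IntegrableOn (fun t ↦ w t * D t) (Ioc a (2 * a)) := hwDi.mono_set hsub2
  have hsD : ∫ t in Ioc 0 (2 * a), D t = (∫ t in Ioc 0 a, D t) + ∫ t in Ioc a (2 * a), D t := by
    rw [← hunion, setIntegral_union hdisj measurableSet_Ioc hDi1 hDi2]
  have hswD : ∫ t in Ioc 0 (2 * a), w t * D t =
      (∫ t in Ioc 0 a, w t * D t) + ∫ t in Ioc a (2 * a), w t * D t := by
    rw [← hunion, setIntegral_union hdisj measurableSet_Ioc hwDi1 hwDi2]
  -- piece `(0, a]`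
  have h1 : w a * ∫ t in Ioc 0 a, D t ≤ ∫ t in Ioc 0 a, w t * D t := by
    rw [← integral_const_mul]
    refine setIntegral_mono_on (hDi1.const_mul _) hwDi1 measurableSet_Ioc fun t ht ↦ ?_
    exact mul_le_mul_of_nonneg_right (hw ht.1 ht.2 (by linarith [ht.2]))
      (hD0 t ⟨ht.1, ht.2.trans (by linarith)⟩)
  -- piece `(a, 2a]`
  have hvol : volume.real (Ioc a (2 * a)) = a := by
    rw [Real.volume_real_Ioc_of_le (by linarith)]
    ring
  have hci : IntegrableOn (fun _ : ℝ ↦ w a * M) (Ioc a (2 * a)) := continuous_const.integrableOn_Ioc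
  have hI1 : IntegrableOn (fun t ↦ M * w t + w a * D t) (Ioc a (2 * a)) :=
    (hwi.const_mul M).add (hDi2.const_mul _)
  have h2 : M * (∫ t in Ioc a (2 * a), w t) + w a * ((∫ t in Ioc a (2 * a), D t) - M * a) ≤
      ∫ t in Ioc a (2 * a), w t * D t := by
    have hlhs : M * (∫ t in Ioc a (2 * a), w t) + w a * ((∫ t in Ioc a (2 * a), D t) - M * a) =
        ∫ t in Ioc a (2 * a), (M * w t + w a * D t - w a * M) := by
      rw [integral_sub hI1 hci, integral_add (hwi.const_mul M) (hDi2.const_mul _), integral_const_mul,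
        integral_const_mul, setIntegral_const, hvol, smul_eq_mul]
      ring
    rw [hlhs]
    refine setIntegral_mono_on (hI1.sub hci) hwDi2 measurableSet_Ioc fun t ht ↦ ?_
    have hapos : 0 < a := lt_of_le_of_lt ha ht.1 |> fun h ↦ by linarith [ht.1, ht.2]
    have ht0 : t ∈ Ioc 0 (2 * a) := ⟨by linarith [ht.1], ht.2⟩
    have hwt : w t ≤ w a := hw hapos ht.1.le ht.2
    nlinarith [hDM t ht0, hD0 t ht0, hwt, hwa]
  -- combine
  have hkey : w a * (∫ t in Ioc 0 a, D t) + w a * ((∫ t in Ioc a (2 * a), D t) - M * a) =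
      w a * ((∫ t in Ioc 0 (2 * a), D t) - M * a) := by
    rw [hsD]
    ring
  have hnn : 0 ≤ w a * ((∫ t in Ioc 0 (2 * a), D t) - M * a) :=
    mul_nonneg hwa (sub_nonneg.2 hmass)
  linarith [h1, h2, hswD, hkey, hnn]

/-! ## The archimedean density `w(t) = e^{t/2}/(2 sinh t)` -/

/-- `w(t) = 1/(e^{t/2} − e^{-3t/2})` for `t > 0`. [folklore] -/
theorem weilArchDensity_eq_inv {t : ℝ} (ht : 0 < t) :
    weilArchDensity t = (Real.exp (t / 2) - Real.exp (-(3 * t / 2)))⁻¹ := by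
  have hden1 : Real.exp t - Real.exp (-t) ≠ 0 :=
    (sub_pos.2 (Real.exp_lt_exp.2 (by linarith))).ne'
  have hden2 : Real.exp (t / 2) - Real.exp (-(3 * t / 2)) ≠ 0 :=
    (sub_pos.2 (Real.exp_lt_exp.2 (by linarith))).ne'
  have h2 : 2 * Real.sinh t = Real.exp t - Real.exp (-t) := by
    rw [Real.sinh_eq]
    ring
  unfold weilArchDensity
  rw [h2, inv_eq_one_div, div_eq_div_iff hden1 hden2, one_mul, mul_sub, ← Real.exp_add,
    ← Real.exp_add]
  have e1 : t / 2 + t / 2 = t := by ring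
  have e2 : t / 2 + -(3 * t / 2) = -t := by ring
  rw [e1, e2]

/-- `w` is non-increasing on `(0, ∞)` (`e^{t/2} − e^{-3t/2}` increases). [folklore] -/
theorem weilArchDensity_antitoneOn : AntitoneOn weilArchDensity (Ioi 0) := by
  intro s hs t ht hst
  rw [weilArchDensity_eq_inv (mem_Ioi.1 hs), weilArchDensity_eq_inv (mem_Ioi.1 ht)]
  have hs0 : (0 : ℝ) < s := hs
  refine inv_anti₀ (sub_pos.2 (Real.exp_lt_exp.2 (by linarith))) ?_
  exact sub_le_sub (Real.exp_le_exp.2 (by linarith)) (Real.exp_le_exp.2 (by linarith))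

/-- Lower bound `w(t) ≥ e^{-t/2}/(2t)` for `t > 0` (`1 − e^{-2t} ≤ 2t`). [folklore] -/
theorem exp_neg_half_div_le_weilArchDensity {t : ℝ} (ht : 0 < t) :
    Real.exp (-(t / 2)) / (2 * t) ≤ weilArchDensity t := by
  have hsinh : 0 < 2 * Real.sinh t := mul_pos two_pos (Real.sinh_pos_iff.2 ht)
  unfold weilArchDensity
  rw [div_le_div_iff₀ (by positivity) hsinh]
  have eA : Real.exp (-(t / 2)) * Real.exp t = Real.exp (t / 2) := by
    rw [← Real.exp_add]
    congr 1
    ring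
  have eB : Real.exp (-(t / 2)) * Real.exp (-t) = Real.exp (t / 2) * Real.exp (-(2 * t)) := by
    rw [← Real.exp_add, ← Real.exp_add]
    congr 1
    ring
  have h1 : 1 - Real.exp (-(2 * t)) ≤ 2 * t := by linarith [Real.add_one_le_exp (-(2 * t))]
  calc Real.exp (-(t / 2)) * (2 * Real.sinh t)
      = Real.exp (-(t / 2)) * Real.exp t - Real.exp (-(t / 2)) * Real.exp (-t) := by
        rw [Real.sinh_eq]
        ring
    _ = Real.exp (t / 2) * (1 - Real.exp (-(2 * t))) := by
        rw [eA, eB]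
        ring
    _ ≤ Real.exp (t / 2) * (2 * t) := mul_le_mul_of_nonneg_left h1 (Real.exp_pos _).le

/-- Upper bound `w(t) ≤ e^{t/2}/(2t)` for `t > 0` (`sinh t ≥ t`). [folklore] -/
theorem weilArchDensity_le_exp_half_div {t : ℝ} (ht : 0 < t) :
    weilArchDensity t ≤ Real.exp (t / 2) / (2 * t) := by
  unfold weilArchDensity
  exact div_le_div_of_nonneg_left (Real.exp_pos _).le (by positivity)
    (by linarith [Real.self_le_sinh_iff.2 ht.le])

/-- `w` is integrable on `(c, ∞)` for `c > 0` (`w(t) ≤ e^{-t/2}/(1 − e^{-2c})` there). [folklore] -/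
theorem integrableOn_weilArchDensity_Ioi {c : ℝ} (hc : 0 < c) :
    IntegrableOn weilArchDensity (Ioi c) := by
  have hK : 0 < 1 - Real.exp (-(2 * c)) := sub_pos.2 (Real.exp_lt_one_iff.2 (by linarith))
  refine Integrable.mono'
    ((exp_neg_integrableOn_Ioi c (by norm_num : (0 : ℝ) < 1 / 2)).div_const (1 - Real.exp (-(2 * c))))
    ?_ ?_
  · exact ((Real.continuous_exp.comp (continuous_id.div_const 2)).measurable.div
      (continuous_const.mul Real.continuous_sinh).measurable).aestronglyMeasurable
  · refine (ae_restrict_iff' measurableSet_Ioi).2 (Eventually.of_forall fun t (ht : c < t) ↦ ?_)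
    have ht0 : 0 < t := hc.trans ht
    have hsinh : 0 < 2 * Real.sinh t := mul_pos two_pos (Real.sinh_pos_iff.2 ht0)
    rw [Real.norm_of_nonneg (weilArchDensity_pos ht0).le]
    unfold weilArchDensity
    rw [div_le_div_iff₀ hsinh hK]
    have eA : Real.exp (-(1 / 2) * t) * Real.exp t = Real.exp (t / 2) := by
      rw [← Real.exp_add]
      congr 1
      ring
    have eB : Real.exp (-(1 / 2) * t) * Real.exp (-t) = Real.exp (t / 2) * Real.exp (-(2 * t)) := by
      rw [← Real.exp_add, ← Real.exp_add]
      congr 1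
      ring
    have hmono : Real.exp (-(2 * t)) ≤ Real.exp (-(2 * c)) := Real.exp_le_exp.2 (by linarith)
    calc Real.exp (t / 2) * (1 - Real.exp (-(2 * c)))
        ≤ Real.exp (t / 2) * (1 - Real.exp (-(2 * t))) :=
          mul_le_mul_of_nonneg_left (by linarith) (Real.exp_pos _).le
      _ = Real.exp (-(1 / 2) * t) * Real.exp t - Real.exp (-(1 / 2) * t) * Real.exp (-t) := by
          rw [eA, eB]
          ring
      _ = Real.exp (-(1 / 2) * t) * (2 * Real.sinh t) := by
          rw [Real.sinh_eq]
          ring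

/-! ## The gap below: mean-zero functions -/

/-- **Lower bound for mean-zero functions.** For an `L²`-normalised test function `g` on
`[-a, a]` with `∫ g = 0`, `∫_{(0,2a]} w(t) D_t(g) dt ≥ 4 ∫_a^{2a} w ≥ 2 e^{-a} log 2`: bathtub with
`M = 4` (`D_t ≤ 4`, `∫₀^{2a} D_t dt = 4a`), then `w(t) ≥ e^{-t/2}/(2t) ≥ e^{-a}/(2t)` on `(a, 2a]`
and `∫_a^{2a} dt/(2t) = (log 2)/2`. (The rescaled, sharp form of this bound is the second
eigenvalue of the jump part of Suzuki's `𝓛`; the crude value `2 log 2` already exceeds the Rayleigh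
quotient `≈ 1` of the plateau below.) [folklore] -/
theorem gap_lower_bound (hg : IsWeilTest g) {a : ℝ} (ha : 0 < a) (hsupp : tsupport g ⊆ Icc (-a) a)
    (hnorm : ∫ x : ℝ, ‖g x‖ ^ 2 = 1) (hmean : ∫ x : ℝ, g x = 0) :
    2 * Real.exp (-a) * Real.log 2 ≤
      ∫ t in Ioc 0 (2 * a), weilArchDensity t * weilIncrement g t := by
  have hDc := continuous_weilIncrement hg
  have hwi : IntegrableOn weilArchDensity (Ioc a (2 * a)) :=
    (integrableOn_weilArchDensity_Ioi ha).mono_set Ioc_subset_Ioi_self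
  have hmass : 4 * a ≤ ∫ t in Ioc 0 (2 * a), weilIncrement g t := by
    rw [← intervalIntegral.integral_of_le (by linarith : (0 : ℝ) ≤ 2 * a),
      intervalIntegral_weilIncrement hg ha.le hsupp, hnorm, hmean, norm_zero]
    norm_num
  have hbath := setIntegral_Ioc_bathtub (w := weilArchDensity) (D := weilIncrement g) (M := 4) ha.le
    (fun s t hs hst _ ↦ weilArchDensity_antitoneOn (mem_Ioi.2 hs) (mem_Ioi.2 (hs.trans_le hst)) hst)
    (weilArchDensity_pos ha).le (fun t _ ↦ weilIncrement_nonneg g t)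
    (fun t _ ↦ by simpa [hnorm] using weilIncrement_le hg t) hDc.integrableOn_Ioc
    ((integrableOn_weilArchDensity_mul_weilIncrement hg).mono_set Ioc_subset_Ioi_self) hwi hmass
  -- `4 ∫_{(a,2a]} w ≥ 2 e^{-a} log 2`
  have hci : IntegrableOn (fun t : ℝ ↦ Real.exp (-a) / (2 * t)) (Ioc a (2 * a)) := by
    refine (ContinuousOn.integrableOn_compact isCompact_Icc ?_).mono_set Ioc_subset_Icc_self
    exact continuousOn_const.div (continuousOn_const.mul continuousOn_id)
      fun t ht ↦ by have : 0 < t := ha.trans_le ht.1; positivity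
  have hle : ∫ t in Ioc a (2 * a), Real.exp (-a) / (2 * t) ≤ ∫ t in Ioc a (2 * a), weilArchDensity t := by
    refine setIntegral_mono_on hci hwi measurableSet_Ioc fun t ht ↦ ?_
    have ht0 : 0 < t := ha.trans ht.1
    calc Real.exp (-a) / (2 * t) ≤ Real.exp (-(t / 2)) / (2 * t) := by
          gcongr
          linarith [ht.2]
      _ ≤ weilArchDensity t := exp_neg_half_div_le_weilArchDensity ht0
  have hval : ∫ t in Ioc a (2 * a), Real.exp (-a) / (2 * t) = Real.exp (-a) / 2 * Real.log 2 := by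
    have h1 : ∫ t in Ioc a (2 * a), Real.exp (-a) / (2 * t) =
        ∫ t in a..(2 * a), Real.exp (-a) / 2 * t⁻¹ := by
      rw [intervalIntegral.integral_of_le (by linarith)]
      congr 1 with t
      ring
    rw [h1, intervalIntegral.integral_const_mul, integral_inv_of_pos ha (by linarith),
      show 2 * a / a = 2 by field_simp]
  linarith

/-! ## The gap above: a smooth plateau as trial function -/

/-- **Translates of a unimodal profile.** If `B : ℝ → ℝ` takes values in `[0, 1]` and is
non-increasing in `|x|`, then for `t ≥ 0`, `∫ |B(x + t) − B(x)| dx ≤ 2t`: the difference is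
`≥ 0` for `x ≤ -t/2` and `≤ 0` for `x ≥ -t/2`, so the integral telescopes to
`2 ∫_{(-t/2, t/2]} B ≤ 2t`. [folklore] -/
theorem integral_abs_sub_le_of_plateau {B : ℝ → ℝ} (hBi : Integrable B)
    (h01 : ∀ x, B x ∈ Icc (0 : ℝ) 1) (hmono : ∀ x y, |x| ≤ |y| → B y ≤ B x) {t : ℝ} (ht : 0 ≤ t) :
    ∫ x : ℝ, |B (x + t) - B x| ≤ 2 * t := by
  set c : ℝ := -(t / 2) with hc
  have hBti : Integrable (fun x ↦ B (x + t)) := hBi.comp_add_right t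
  have hle : ∀ x, x ≤ c → B x ≤ B (x + t) := fun x hx ↦ hmono _ _ (by
    have hx0 : x ≤ 0 := by linarith
    rw [abs_of_nonpos hx0, abs_le]
    constructor <;> linarith)
  have hge : ∀ x, c < x → B (x + t) ≤ B x := fun x hx ↦ hmono _ _ (by
    have hx0 : 0 ≤ x + t := by linarith
    rw [abs_of_nonneg hx0, abs_le]
    constructor <;> linarith)
  -- split the line at `c`
  have hfi : Integrable fun x ↦ |B (x + t) - B x| := (hBti.sub hBi).abs
  have hsplit := integral_add_compl (measurableSet_Iic (a := c)) hfi
  rw [compl_Iic] at hsplit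
  rw [← hsplit]
  -- evaluate the two pieces
  have hpiece1 : ∫ x in Iic c, |B (x + t) - B x| = (∫ x in Iic c, B (x + t)) - ∫ x in Iic c, B x := by
    rw [← integral_sub hBti.integrableOn hBi.integrableOn]
    refine setIntegral_congr_fun measurableSet_Iic fun x hx ↦ ?_
    exact abs_of_nonneg (sub_nonneg.2 (hle x hx))
  have hpiece2 : ∫ x in Ioi c, |B (x + t) - B x| = (∫ x in Ioi c, B x) - ∫ x in Ioi c, B (x + t) := by
    rw [← integral_sub hBi.integrableOn hBti.integrableOn]
    refine setIntegral_congr_fun measurableSet_Ioi fun x hx ↦ ?_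
    rw [abs_sub_comm]
    exact abs_of_nonneg (sub_nonneg.2 (hge x hx))
  -- translate the shifted pieces
  have hshift1 : ∫ x in Iic c, B (x + t) = ∫ x in Iic (c + t), B x := by
    rw [← integral_indicator measurableSet_Iic, ← integral_indicator measurableSet_Iic]
    conv_rhs => rw [← integral_add_right_eq_self _ t]
    congr 1 with x
    simp only [Set.indicator_apply, mem_Iic, add_le_add_iff_right]
  have hshift2 : ∫ x in Ioi c, B (x + t) = ∫ x in Ioi (c + t), B x := by
    rw [← integral_indicator measurableSet_Ioi, ← integral_indicator measurableSet_Ioi]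
    conv_rhs => rw [← integral_add_right_eq_self _ t]
    congr 1 with x
    simp only [Set.indicator_apply, mem_Ioi, add_lt_add_iff_right]
  have hct : c + t = t / 2 := by rw [hc]; ring
  rw [hpiece1, hpiece2, hshift1, hshift2, hct]
  -- telescope to `2 ∫_{(-t/2, t/2]} B`
  have hcle : c ≤ t / 2 := by rw [hc]; linarith
  have hIic : ∫ x in Iic (t / 2), B x = (∫ x in Iic c, B x) + ∫ x in Ioc c (t / 2), B x := by
    rw [← Iic_union_Ioc_eq_Iic hcle, setIntegral_union ?_ measurableSet_Ioc hBi.integrableOn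
      hBi.integrableOn]
    exact Set.disjoint_left.2 fun x hx hx' ↦ (not_lt.2 (mem_Iic.1 hx)) hx'.1
  have hIoi : ∫ x in Ioi c, B x = (∫ x in Ioc c (t / 2), B x) + ∫ x in Ioi (t / 2), B x := by
    rw [← Ioc_union_Ioi_eq_Ioi hcle, setIntegral_union Ioc_disjoint_Ioi_same measurableSet_Ioi
      hBi.integrableOn hBi.integrableOn]
  have hmid : ∫ x in Ioc c (t / 2), B x ≤ t := by
    have h1 : ∫ x in Ioc c (t / 2), B x ≤ ∫ x in Ioc c (t / 2), (1 : ℝ) :=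
      setIntegral_mono_on hBi.integrableOn continuous_const.integrableOn_Ioc measurableSet_Ioc
        fun x _ ↦ (h01 x).2
    have h2 : ∫ x in Ioc c (t / 2), (1 : ℝ) = t := by
      rw [setIntegral_const, Real.volume_real_Ioc_of_le hcle, smul_eq_mul, mul_one, hc]
      ring
    linarith
  linarith

/-- Hence the increments of such a profile (as a complex-valued function) satisfy `D_t(B) ≤ 2t`
for `t ≥ 0` (`|B(x+t) − B(x)|² ≤ |B(x+t) − B(x)|`, the values lying in `[0, 1]`). [folklore] -/
theorem weilIncrement_ofReal_le_of_plateau {B : ℝ → ℝ} (hBi : Integrable B)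
    (h01 : ∀ x, B x ∈ Icc (0 : ℝ) 1) (hmono : ∀ x y, |x| ≤ |y| → B y ≤ B x) {t : ℝ} (ht : 0 ≤ t) :
    weilIncrement (fun x ↦ ((B x : ℝ) : ℂ)) t ≤ 2 * t := by
  unfold weilIncrement
  have hpt : ∀ x, ‖((B (x + t) : ℝ) : ℂ) - (B x : ℂ)‖ ^ 2 ≤ |B (x + t) - B x| := fun x ↦ by
    rw [← Complex.ofReal_sub, Complex.norm_real, Real.norm_eq_abs, sq]
    have hd : |B (x + t) - B x| ≤ 1 := by
      rw [abs_le]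
      constructor <;> linarith [(h01 (x + t)).1, (h01 (x + t)).2, (h01 x).1, (h01 x).2]
    exact mul_le_of_le_one_left (abs_nonneg _) hd
  calc ∫ x : ℝ, ‖((B (x + t) : ℝ) : ℂ) - (B x : ℂ)‖ ^ 2 ≤ ∫ x : ℝ, |B (x + t) - B x| :=
        integral_mono_of_nonneg (Eventually.of_forall fun _ ↦ by positivity)
          ((hBi.comp_add_right t).sub hBi).abs (Eventually.of_forall hpt)
    _ ≤ 2 * t := integral_abs_sub_le_of_plateau hBi h01 hmono ht

/-- **A smooth even plateau.** For `0 < r < a` there is a `C^∞` function `B : ℝ → [0, 1]` with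
`B = 0` on `{|x| ≥ a}`, `B = 1` on `{|x| ≤ r}`, non-increasing in `|x|`; namely
`B(x) = S((a − x)/(a − r)) · S((a + x)/(a − r))` with Mathlib's `S = Real.smoothTransition`. [folklore] -/
theorem exists_smooth_plateau {r a : ℝ} (hr : 0 < r) (hra : r < a) :
    ∃ B : ℝ → ℝ, ContDiff ℝ ∞ B ∧ (∀ x, B x ∈ Icc (0 : ℝ) 1) ∧ (∀ x, a ≤ |x| → B x = 0) ∧
      (∀ x, |x| ≤ r → B x = 1) ∧ (∀ x y, |x| ≤ |y| → B y ≤ B x) := by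
  set d : ℝ := a - r with hd
  have hd0 : 0 < d := by rw [hd]; linarith
  set B : ℝ → ℝ := fun x ↦ Real.smoothTransition ((a - x) / d) * Real.smoothTransition ((a + x) / d)
    with hB
  have heven : ∀ x, B (-x) = B x := fun x ↦ by
    simp only [hB, sub_neg_eq_add, ← sub_eq_add_neg]
    exact mul_comm _ _
  -- on `[0, ∞)` the second factor is `1` and the first is non-increasing
  have hsecond : ∀ x, 0 ≤ x → Real.smoothTransition ((a + x) / d) = 1 := fun x hx ↦
    Real.smoothTransition.one_of_one_le ((one_le_div hd0).2 (by rw [hd]; linarith))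
  have hanti : ∀ u v, 0 ≤ u → u ≤ v → B v ≤ B u := fun u v hu huv ↦ by
    simp only [hB, hsecond u hu, hsecond v (hu.trans huv), mul_one]
    exact Real.smoothTransition.monotone (div_le_div_of_nonneg_right (by linarith) hd0.le)
  refine ⟨B, ?_, ?_, ?_, ?_, ?_⟩
  · exact (Real.smoothTransition.contDiff.comp ((contDiff_const.sub contDiff_id).div_const d)).mul
      (Real.smoothTransition.contDiff.comp ((contDiff_const.add contDiff_id).div_const d))
  · intro x
    exact ⟨mul_nonneg (Real.smoothTransition.nonneg _) (Real.smoothTransition.nonneg _),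
      mul_le_one₀ (Real.smoothTransition.le_one _) (Real.smoothTransition.nonneg _)
        (Real.smoothTransition.le_one _)⟩
  · intro x hx
    rcases le_or_gt 0 x with h0 | h0
    · rw [abs_of_nonneg h0] at hx
      have : Real.smoothTransition ((a - x) / d) = 0 :=
        Real.smoothTransition.zero_of_nonpos (div_nonpos_of_nonpos_of_nonneg (by linarith) hd0.le)
      simp only [hB, this, zero_mul]
    · rw [abs_of_neg h0] at hx
      have : Real.smoothTransition ((a + x) / d) = 0 :=
        Real.smoothTransition.zero_of_nonpos (div_nonpos_of_nonpos_of_nonneg (by linarith) hd0.le)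
      simp only [hB, this, mul_zero]
  · intro x hx
    have h1 : Real.smoothTransition ((a - x) / d) = 1 :=
      Real.smoothTransition.one_of_one_le ((one_le_div hd0).2 (by rw [hd]; linarith [le_abs_self x]))
    have h2 : Real.smoothTransition ((a + x) / d) = 1 :=
      Real.smoothTransition.one_of_one_le ((one_le_div hd0).2 (by rw [hd]; linarith [neg_abs_le x]))
    simp only [hB, h1, h2, mul_one]
  · intro x y hxy
    have hx : B x = B |x| := by
      rcases le_or_gt 0 x with h | h
      · rw [abs_of_nonneg h]
      · rw [abs_of_neg h, heven]
    have hy : B y = B |y| := by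
      rcases le_or_gt 0 y with h | h
      · rw [abs_of_nonneg h]
      · rw [abs_of_neg h, heven]
    rw [hx, hy]
    exact hanti _ _ (abs_nonneg x) hxy

/-! ## The energy on a small window -/

/-- **The energy on a small window splits at `2a`.** For `0 < a`, `2a ≤ log 2` and a test function
`g` with `tsupport g ⊆ [-a, a]`:
`𝓔_a(g) = ∫_{(0,2a]} w(t) D_t(g) dt + 2‖g‖₂² ∫_{2a}^∞ w(t) dt` — no prime power has `log n < 2a`
except `n = 0, 1` where `Λ = 0`, and `D_t(g) = 2‖g‖₂²` beyond `2a`. (Suzuki's (4.5): for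
`0 < a < (log 2)/2` the prime sum is empty.) [cite: Suzuki2026, §4.2 eq. (4.5) and §5.1] -/
theorem weilDirichletEnergy_eq_of_two_mul_le_log_two (hg : IsWeilTest g) {a : ℝ} (ha : 0 < a)
    (ha2 : 2 * a ≤ Real.log 2) (hsupp : tsupport g ⊆ Icc (-a) a) :
    weilDirichletEnergy a g = (∫ t in Ioc 0 (2 * a), weilArchDensity t * weilIncrement g t) +
      2 * (∫ x : ℝ, ‖g x‖ ^ 2) * ∫ t in Ioi (2 * a), weilArchDensity t := by
  unfold weilDirichletEnergy
  have hprime : ∑ n ∈ weilPrimeIndex a, (Λ n : ℝ) / Real.sqrt n * weilIncrement g (Real.log n) = 0 := by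
    refine Finset.sum_eq_zero fun n hn ↦ ?_
    rw [mem_weilPrimeIndex] at hn
    have hn2 : n < 2 := by
      by_contra h
      rw [not_lt] at h
      have : Real.log 2 ≤ Real.log n := Real.log_le_log two_pos (by exact_mod_cast h)
      linarith
    interval_cases n <;> simp
  rw [hprime, zero_add]
  have hI := integrableOn_weilArchDensity_mul_weilIncrement hg
  have hunion : Ioc 0 (2 * a) ∪ Ioi (2 * a) = Ioi 0 := Ioc_union_Ioi_eq_Ioi (by linarith)
  rw [← hunion, setIntegral_union Ioc_disjoint_Ioi_same measurableSet_Ioi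
    (hI.mono_set Ioc_subset_Ioi_self) (hI.mono_set (Ioi_subset_Ioi (by linarith)))]
  congr 1
  have heq : EqOn (fun t ↦ weilArchDensity t * weilIncrement g t)
      (fun t ↦ weilArchDensity t * (2 * ∫ x : ℝ, ‖g x‖ ^ 2)) (Ioi (2 * a)) := fun t ht ↦ by
    have ht' : 2 * a ≤ |t| := by
      rw [abs_of_pos (by linarith [mem_Ioi.1 ht])]
      exact (mem_Ioi.1 ht).le
    simp only [weilIncrement_eq_of_le_abs hg hsupp ht']
  rw [setIntegral_congr_fun measurableSet_Ioi heq, integral_mul_const]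
  ring

/-- **Upper bound for the plateau's inner energy**: if `B : ℝ → [0,1]` is non-increasing in `|x|`
and `x ↦ (B x : ℂ)` is a test function, then `∫_{(0,2a]} w(t) D_t(B) dt ≤ 2a e^{a}` for `a > 0`
(`w(t) D_t(B) ≤ (e^{t/2}/2t) · 2t = e^{t/2} ≤ e^{a}` on `(0, 2a]`). [folklore] -/
theorem setIntegral_weilArchDensity_mul_weilIncrement_plateau_le {B : ℝ → ℝ}
    (hBt : IsWeilTest fun x ↦ ((B x : ℝ) : ℂ)) (h01 : ∀ x, B x ∈ Icc (0 : ℝ) 1)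
    (hmono : ∀ x y, |x| ≤ |y| → B y ≤ B x) {a : ℝ} (ha : 0 < a) :
    ∫ t in Ioc 0 (2 * a), weilArchDensity t * weilIncrement (fun x ↦ ((B x : ℝ) : ℂ)) t ≤
      2 * a * Real.exp a := by
  have hBi : Integrable B := by
    have hc : Continuous fun x ↦ ((B x : ℝ) : ℂ) := hBt.1.continuous
    have hB : Continuous B := by
      simpa [Function.comp_def] using Complex.continuous_re.comp hc
    refine hB.integrable_of_hasCompactSupport ?_
    have h := hBt.2
    rw [hasCompactSupport_iff_eventuallyEq] at h ⊢
    filter_upwards [h] with x hx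
    simpa using congrArg Complex.re hx
  have hwDi := (integrableOn_weilArchDensity_mul_weilIncrement hBt).mono_set
    (Ioc_subset_Ioi_self : Ioc (0 : ℝ) (2 * a) ⊆ Ioi 0)
  calc ∫ t in Ioc 0 (2 * a), weilArchDensity t * weilIncrement (fun x ↦ ((B x : ℝ) : ℂ)) t
      ≤ ∫ t in Ioc 0 (2 * a), Real.exp a := by
        refine setIntegral_mono_on hwDi continuous_const.integrableOn_Ioc measurableSet_Ioc
          fun t ht ↦ ?_
        have ht0 : 0 < t := ht.1
        calc weilArchDensity t * weilIncrement (fun x ↦ ((B x : ℝ) : ℂ)) t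
            ≤ Real.exp (t / 2) / (2 * t) * (2 * t) :=
              mul_le_mul (weilArchDensity_le_exp_half_div ht0)
                (weilIncrement_ofReal_le_of_plateau hBi h01 hmono ht0.le)
                (weilIncrement_nonneg _ _) (by positivity)
          _ = Real.exp (t / 2) := by field_simp
          _ ≤ Real.exp a := Real.exp_le_exp.2 (by linarith [ht.2])
    _ = 2 * a * Real.exp a := by
        rw [setIntegral_const, Real.volume_real_Ioc_of_le (by linarith), smul_eq_mul]
        ring

/-- **The pole form of the plateau is `O(a²)`**: for `B : ℝ → [0, 1]` vanishing on `{|x| ≥ a}`,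
`P(B) ≤ 2 |∫ B cosh(t/2)|² ≤ 2 (2a cosh(a/2))² = 8 a² cosh²(a/2)`. [folklore] -/
theorem weilPoleForm_plateau_le {B : ℝ → ℝ} {a : ℝ} (ha : 0 < a) (h01 : ∀ x, B x ∈ Icc (0 : ℝ) 1)
    (hzero : ∀ x, a ≤ |x| → B x = 0) :
    weilPoleForm (fun x ↦ ((B x : ℝ) : ℂ)) ≤ 8 * a ^ 2 * Real.cosh (a / 2) ^ 2 := by
  unfold weilPoleForm
  set C : ℂ := ∫ t : ℝ, ((B t : ℝ) : ℂ) * (Real.cosh (t / 2) : ℂ) with hC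
  set S : ℂ := ∫ t : ℝ, ((B t : ℝ) : ℂ) * (Real.sinh (t / 2) : ℂ) with hS
  have hCle : ‖C‖ ≤ 2 * a * Real.cosh (a / 2) := by
    have hfun : (fun t : ℝ ↦ ((B t : ℝ) : ℂ) * (Real.cosh (t / 2) : ℂ)) =
        fun t ↦ ((B t * Real.cosh (t / 2) : ℝ) : ℂ) := by
      funext t
      push_cast
      ring
    rw [hC, hfun, integral_complex_ofReal, Complex.norm_real, Real.norm_eq_abs]
    have hind : Integrable (fun t : ℝ ↦ (Icc (-a) a).indicator (fun _ ↦ Real.cosh (a / 2)) t) :=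
      (continuous_const.integrableOn_Icc (a := -a) (b := a)).integrable_indicator measurableSet_Icc
    calc |∫ t : ℝ, B t * Real.cosh (t / 2)| ≤ ∫ t : ℝ, |B t * Real.cosh (t / 2)| :=
          abs_integral_le_integral_abs
      _ ≤ ∫ t : ℝ, (Icc (-a) a).indicator (fun _ ↦ Real.cosh (a / 2)) t := by
          refine integral_mono_of_nonneg (Eventually.of_forall fun _ ↦ abs_nonneg _) hind
            (Eventually.of_forall fun t ↦ ?_)
          show |B t * Real.cosh (t / 2)| ≤ (Icc (-a) a).indicator (fun _ ↦ Real.cosh (a / 2)) t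
          by_cases ht : t ∈ Icc (-a) a
          · rw [indicator_of_mem ht, abs_mul, abs_of_nonneg (h01 t).1,
              abs_of_nonneg (Real.cosh_pos _).le]
            have hcosh : Real.cosh (t / 2) ≤ Real.cosh (a / 2) := by
              rw [Real.cosh_le_cosh, abs_div, abs_div, abs_two, abs_of_pos ha]
              exact div_le_div_of_nonneg_right (abs_le.2 ⟨ht.1, ht.2⟩) two_pos.le
            calc B t * Real.cosh (t / 2) ≤ 1 * Real.cosh (a / 2) :=
                  mul_le_mul (h01 t).2 hcosh (Real.cosh_pos _).le zero_le_one
              _ = Real.cosh (a / 2) := one_mul _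
          · rw [indicator_of_notMem ht]
            have hta : a ≤ |t| := by
              by_contra hlt
              rw [not_le] at hlt
              exact ht ⟨(abs_lt.1 hlt).1.le, (abs_lt.1 hlt).2.le⟩
            rw [hzero t hta, zero_mul, abs_zero]
      _ = 2 * a * Real.cosh (a / 2) := by
          rw [integral_indicator measurableSet_Icc, setIntegral_const,
            Real.volume_real_Icc_of_le (by linarith), smul_eq_mul]
          ring
  have hC2 : ‖C‖ ^ 2 ≤ (2 * a * Real.cosh (a / 2)) ^ 2 := pow_le_pow_left₀ (norm_nonneg _) hCle 2
  nlinarith [hC2, sq_nonneg ‖S‖]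

/-- `‖B‖₂² ≥ 2r` for a non-negative profile `B` equal to `1` on `[-r, r]` (as a complex test
function). [folklore] -/
theorem two_mul_le_integral_norm_sq_plateau {B : ℝ → ℝ} (hBt : IsWeilTest fun x ↦ ((B x : ℝ) : ℂ))
    {r : ℝ} (hr : 0 ≤ r) (hone : ∀ x, |x| ≤ r → B x = 1) :
    2 * r ≤ ∫ x : ℝ, ‖((B x : ℝ) : ℂ)‖ ^ 2 := by
  have hind : Integrable (fun x : ℝ ↦ (Icc (-r) r).indicator (fun _ ↦ (1 : ℝ)) x) :=
    (continuous_const.integrableOn_Icc (a := -r) (b := r)).integrable_indicator measurableSet_Icc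
  calc 2 * r = ∫ x : ℝ, (Icc (-r) r).indicator (fun _ ↦ (1 : ℝ)) x := by
        rw [integral_indicator measurableSet_Icc, setIntegral_const,
          Real.volume_real_Icc_of_le (by linarith), smul_eq_mul]
        ring
    _ ≤ ∫ x : ℝ, ‖((B x : ℝ) : ℂ)‖ ^ 2 := by
        refine integral_mono hind hBt.integrable_norm_sq fun x ↦ ?_
        by_cases hx : x ∈ Icc (-r) r
        · rw [indicator_of_mem hx, hone x (abs_le.2 ⟨hx.1, hx.2⟩)]
          simp
        · rw [indicator_of_notMem hx]
          positivity

/-- **The Rayleigh quotient bounds the ground energy**: for a test function `h ≠ 0` on `[-a, a]`,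
`ε(a) ≤ Re Q(h)/‖h‖₂²` (normalise `h`, `Q(c h) = |c|² Q(h)`, and `ε(a)` is the infimum over the
sphere, bounded below by `bddBelow_weilQuadratic_sphere_holds`). (Suzuki, Cor. 1.2: `λ_a` is the
infimum of the Rayleigh quotient.) [cite: Suzuki2026, Cor. 1.2] -/
theorem weilGroundEnergy_le_div {h : ℝ → ℂ} (hh : IsWeilTest h) {a : ℝ}
    (hsupp : tsupport h ⊆ Icc (-a) a) (hpos : 0 < ∫ t : ℝ, ‖h t‖ ^ 2) :
    weilGroundEnergy a ≤ (weilQuadratic h).re / ∫ t : ℝ, ‖h t‖ ^ 2 := by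
  set N2 : ℝ := ∫ t : ℝ, ‖h t‖ ^ 2 with hN2
  set c : ℝ := (Real.sqrt N2)⁻¹ with hc
  have hcpos : 0 < c := inv_pos.2 (Real.sqrt_pos.2 hpos)
  have hh't : IsWeilTest fun t ↦ (c : ℂ) * h t := hh.const_mul c
  have hsupp' : tsupport (fun t ↦ (c : ℂ) * h t) ⊆ Icc (-a) a :=
    tsupport_mul_subset_right.trans hsupp
  have hnorm' : ∫ t : ℝ, ‖(c : ℂ) * h t‖ ^ 2 = 1 := by
    simp only [norm_mul, mul_pow, Complex.norm_real, Real.norm_of_nonneg hcpos.le]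
    rw [integral_const_mul, hc, inv_pow, Real.sq_sqrt hpos.le, inv_mul_cancel₀ hpos.ne']
  have hmem : (weilQuadratic fun t ↦ (c : ℂ) * h t).re ∈
      {x : ℝ | ∃ g : ℝ → ℂ, IsWeilTest g ∧ tsupport g ⊆ Icc (-a) a ∧
        ∫ t : ℝ, ‖g t‖ ^ 2 = 1 ∧ x = (weilQuadratic g).re} :=
    ⟨fun t ↦ (c : ℂ) * h t, hh't, hsupp', hnorm', rfl⟩
  have hle : weilGroundEnergy a ≤ (weilQuadratic fun t ↦ (c : ℂ) * h t).re :=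
    csInf_le (bddBelow_weilQuadratic_sphere_holds a) hmem
  have hQ' : (weilQuadratic fun t ↦ (c : ℂ) * h t).re = c * c * (weilQuadratic h).re := by
    rw [weilQuadratic_const_mul, Complex.normSq_ofReal, Complex.re_ofReal_mul]
  have hcc : c * c = 1 / N2 := by
    rw [hc, ← mul_inv, Real.mul_self_sqrt hpos.le, one_div]
  rw [hQ', hcc] at hle
  simpa only [one_div, inv_mul_eq_div] using hle

/-! ## Numerics -/

/-- The numerical inequality behind the gap: for `0 < a ≤ 1/100`,
`2 e^{-a} log 2 − (10/9) e^{a} − (40/9) a cosh²(a/2) − 2(sinh a − a) ≥ 1/10`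
(`log 2 > 0.6931`, `e^{a} ≤ 1 + 2a`, `cosh(a/2) ≤ 1 + a`, `sinh a ≤ 3a/2`). [folklore] -/
theorem suzuki_gap_numerics {a : ℝ} (ha : 0 < a) (ha' : a ≤ 1 / 100) :
    1 / 10 ≤ 2 * Real.exp (-a) * Real.log 2 - 2 * a * Real.exp a / (2 * (9 / 10 * a)) -
      8 * a ^ 2 * Real.cosh (a / 2) ^ 2 / (2 * (9 / 10 * a)) - 2 * (Real.sinh a - a) := by
  have hexp_le : ∀ x : ℝ, 0 < x → x ≤ 1 → Real.exp x ≤ 1 + 2 * x := fun x hx hx1 ↦ by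
    have h := Real.abs_exp_sub_one_le (x := x) (by rw [abs_of_pos hx]; exact hx1)
    rw [abs_of_pos hx] at h
    linarith [(abs_le.1 h).2]
  have h1 : 1 - a ≤ Real.exp (-a) := by linarith [Real.add_one_le_exp (-a)]
  have h2 : Real.exp a ≤ 1 + 2 * a := hexp_le a ha (by linarith)
  have h3 : Real.cosh (a / 2) ≤ 1 + a := by
    rw [Real.cosh_eq]
    have e1 : Real.exp (a / 2) ≤ 1 + 2 * (a / 2) := hexp_le (a / 2) (by positivity) (by linarith)
    have e2 : Real.exp (-(a / 2)) ≤ 1 := Real.exp_le_one_iff.2 (by linarith)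
    linarith
  have h4 : Real.sinh a ≤ 3 / 2 * a := by
    rw [Real.sinh_eq]
    linarith
  have hlog : (0.6931 : ℝ) ≤ Real.log 2 := by linarith [Real.log_two_gt_d9]
  have hden : 2 * (9 / 10 * a) ≠ 0 := by positivity
  have hd1 : 2 * a * Real.exp a / (2 * (9 / 10 * a)) = 10 / 9 * Real.exp a := by
    rw [div_eq_iff hden]
    ring
  have hd2 : 8 * a ^ 2 * Real.cosh (a / 2) ^ 2 / (2 * (9 / 10 * a)) =
      40 / 9 * a * Real.cosh (a / 2) ^ 2 := by
    rw [div_eq_iff hden]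
    ring
  rw [hd1, hd2]
  have hcosh2 : Real.cosh (a / 2) ^ 2 ≤ (1 + a) ^ 2 :=
    pow_le_pow_left₀ (Real.cosh_pos _).le h3 2
  have hcosh2a : a * Real.cosh (a / 2) ^ 2 ≤ a * (1 + a) ^ 2 := mul_le_mul_of_nonneg_left hcosh2 ha.le
  have hprod : (1 - a) * 0.6931 ≤ Real.exp (-a) * Real.log 2 :=
    mul_le_mul h1 hlog (by norm_num) (Real.exp_pos _).le
  have ha2 : a ^ 2 ≤ a / 100 := by nlinarith
  have ha3 : a ^ 3 ≤ a / 10000 := by nlinarith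
  nlinarith [hcosh2a, hprod, h2, h4, ha2, ha3]

/-! ## The gap theorem and Suzuki's Theorem 1.4 -/

/-- **The spectral gap above mean-zero functions on a small window.** For `0 < a ≤ 1/100` and an
`L²`-normalised test function `g` on `[-a, a]` with `∫ g = 0`,
`Re Q(g) ≥ ε(a) + 1/10`. Proof: with the plateau `B` of `exists_smooth_plateau` (`r = 9a/10`),
`Re Q(g) − Re Q(B)/‖B‖₂² = (P(g) − P(B)/‖B‖₂²) + (A(g) − A(B)/‖B‖₂²)` by the Markov
decomposition and `weilDirichletEnergy_eq_of_two_mul_le_log_two` (the tail `2 ∫_{2a}^∞ w` and the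
killing constant `M_a` cancel), and the four bounds `gap_lower_bound`,
`setIntegral_weilArchDensity_mul_weilIncrement_plateau_le`, `Yoshida1992_polar_lower_bound`,
`weilPoleForm_plateau_le` with `‖B‖₂² ≥ 9a/5` leave `≥ 1/10` (`suzuki_gap_numerics`); finally
`ε(a) ≤ Re Q(B)/‖B‖₂²`. This is the variational content of Suzuki's Thm. 1.4 (simplicity and
evenness of the bottom for small `a`). [cite: Suzuki2026, Thm. 1.4 and §5] -/
theorem weilGroundEnergy_add_le_of_integral_eq_zero (hg : IsWeilTest g) {a : ℝ} (ha : 0 < a)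
    (ha' : a ≤ 1 / 100) (hsupp : tsupport g ⊆ Icc (-a) a) (hnorm : ∫ x : ℝ, ‖g x‖ ^ 2 = 1)
    (hmean : ∫ x : ℝ, g x = 0) :
    weilGroundEnergy a + 1 / 10 ≤ (weilQuadratic g).re := by
  -- the plateau
  obtain ⟨B, hBs, hB01, hB0, hB1, hBmono⟩ :=
    exists_smooth_plateau (r := 9 / 10 * a) (a := a) (by positivity) (by linarith)
  set h : ℝ → ℂ := fun x ↦ ((B x : ℝ) : ℂ) with hhdef
  have hsuppB : Function.support h ⊆ Ioo (-a) a := fun x hx ↦ by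
    have hx' : B x ≠ 0 := fun h0 ↦ hx (by simp [hhdef, h0])
    have hlt : |x| < a := lt_of_not_ge fun hle ↦ hx' (hB0 x hle)
    exact ⟨by linarith [(abs_lt.1 hlt).1], (abs_lt.1 hlt).2⟩
  have hht : IsWeilTest h :=
    ⟨Complex.ofRealCLM.contDiff.comp hBs, HasCompactSupport.intro (isCompact_Icc (a := -a) (b := a))
      fun x hx ↦ Function.notMem_support.1 fun hx' ↦ hx (Ioo_subset_Icc_self (hsuppB hx'))⟩
  have hhsupp : tsupport h ⊆ Icc (-a) a :=
    closure_minimal (hsuppB.trans Ioo_subset_Icc_self) isClosed_Icc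
  set N : ℝ := ∫ x : ℝ, ‖h x‖ ^ 2 with hN
  have hNge : 2 * (9 / 10 * a) ≤ N :=
    two_mul_le_integral_norm_sq_plateau hht (by positivity) hB1
  have hNpos : 0 < N := by linarith
  -- decompositions
  have ha2 : 2 * a ≤ Real.log 2 := by linarith [Real.log_two_gt_d9]
  have hQg := weilQuadratic_re_eq_weilPoleForm_add_weilDirichletEnergy_sub hg hsupp
  have hQh := weilQuadratic_re_eq_weilPoleForm_add_weilDirichletEnergy_sub hht hhsupp
  have hEg := weilDirichletEnergy_eq_of_two_mul_le_log_two hg ha ha2 hsupp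
  have hEh := weilDirichletEnergy_eq_of_two_mul_le_log_two hht ha ha2 hhsupp
  rw [hnorm] at hQg hEg
  -- the four bounds
  have hAg : 2 * Real.exp (-a) * Real.log 2 ≤
      ∫ t in Ioc 0 (2 * a), weilArchDensity t * weilIncrement g t :=
    gap_lower_bound hg ha hsupp hnorm hmean
  have hAh : ∫ t in Ioc 0 (2 * a), weilArchDensity t * weilIncrement h t ≤ 2 * a * Real.exp a :=
    setIntegral_weilArchDensity_mul_weilIncrement_plateau_le hht hB01 hBmono ha
  have hPg : -(2 * (Real.sinh a - a)) ≤ weilPoleForm g := by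
    have h1 := Yoshida1992_polar_lower_bound hg hsupp
    rw [two_mul_re_weilMellin_zero_mul_conj_one hg, hnorm, mul_one] at h1
    exact h1
  have hPh : weilPoleForm h ≤ 8 * a ^ 2 * Real.cosh (a / 2) ^ 2 :=
    weilPoleForm_plateau_le ha hB01 hB0
  have hε : weilGroundEnergy a ≤ (weilQuadratic h).re / N := weilGroundEnergy_le_div hht hhsupp hNpos
  -- ratios of the plateau
  set T : ℝ := ∫ t in Ioi (2 * a), weilArchDensity t with hT
  set Ah : ℝ := ∫ t in Ioc 0 (2 * a), weilArchDensity t * weilIncrement h t with hAhdef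
  have hratio : (weilQuadratic h).re / N = weilPoleForm h / N + Ah / N + 2 * T - weilMarkovConstant a := by
    rw [hQh, hEh]
    field_simp
    ring
  have hPhN : weilPoleForm h / N ≤ 8 * a ^ 2 * Real.cosh (a / 2) ^ 2 / (2 * (9 / 10 * a)) :=
    (div_le_div_of_nonneg_right hPh hNpos.le).trans
      (div_le_div_of_nonneg_left (by positivity) (by positivity) hNge)
  have hAhN : Ah / N ≤ 2 * a * Real.exp a / (2 * (9 / 10 * a)) :=
    (div_le_div_of_nonneg_right hAh hNpos.le).trans
      (div_le_div_of_nonneg_left (by positivity) (by positivity) hNge)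
  have hnum := suzuki_gap_numerics ha ha'
  rw [hQg, hEg]
  linarith [hratio, hPhN, hAhN, hnum, hε, hAg, hPg]

/-- **Positivity of the ground energy on small windows** (Yoshida 1992; Bombieri 2000, Thm. 12, in
the tree as `weilQuadratic_coercive`): there is `a₁ > 0` with `ε(a) ≥ 1 > 0` for `0 < a ≤ a₁`.
(Suzuki §5.1 re-derives `λ_a > 0` from `log(1/a) → ∞`.) [cite: Suzuki2026, Thm. 1.4 (positivity) and §5.1] -/
theorem exists_weilGroundEnergy_pos :
    ∃ a₁ : ℝ, 0 < a₁ ∧ ∀ a : ℝ, 0 < a → a ≤ a₁ → 0 < weilGroundEnergy a := by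
  obtain ⟨a₁, ha₁, H⟩ := weilQuadratic_coercive 1
  refine ⟨a₁, ha₁, fun a ha hale ↦ ?_⟩
  have hne : {x : ℝ | ∃ g : ℝ → ℂ, IsWeilTest g ∧ tsupport g ⊆ Icc (-a) a ∧
      ∫ t : ℝ, ‖g t‖ ^ 2 = 1 ∧ x = (weilQuadratic g).re}.Nonempty := by
    obtain ⟨g, hg, hsupp, hnorm⟩ := exists_isWeilTest_sphere ha
    exact ⟨_, g, hg, hsupp, hnorm, rfl⟩
  have h1 : 1 ≤ weilGroundEnergy a := by
    refine le_csInf hne ?_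
    rintro x ⟨g, hg, hsupp, hnorm, rfl⟩
    have h := H a ha hale g hg hsupp
    rwa [hnorm, mul_one] at h
  linarith

/-- **Discharge of `Literature.NumberTheory.LFunctions.Suzuki2026_thm_1_4`** (Suzuki 2026,
Thm. 1.4: for sufficiently small `a > 0` the lowest eigenvalue `λ_a` of Weil's form on `(-a, a)` is
positive and simple with even eigenfunction), in the tree's variational form: with
`a₀ = min (1/100) a₁`, for `0 < a ≤ a₀` one has `0 < ε(a)` (`exists_weilGroundEnergy_pos`) and
`WeilWindowSimpleEven a` with witness `φ = 1` and gap `δ = 1/10`: an odd normalised test function,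
and an even one with `∫ conj 1 · g = 0`, both have `∫ g = 0`, hence `Re Q(g) ≥ ε(a) + 1/10`
(`weilGroundEnergy_add_le_of_integral_eq_zero`). [cite: Suzuki2026, Thm. 1.4] -/
theorem Suzuki2026_thm_1_4_holds : Suzuki2026_thm_1_4 := by
  obtain ⟨a₁, ha₁, H⟩ := exists_weilGroundEnergy_pos
  refine ⟨min (1 / 100) a₁, lt_min (by norm_num) ha₁, fun a ha hale ↦
    ⟨H a ha (hale.trans (min_le_right _ _)), ?_⟩⟩
  have ha' : a ≤ 1 / 100 := hale.trans (min_le_left _ _)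
  refine ⟨fun _ ↦ 1, 1 / 10, by norm_num, fun g hg hsupp hnorm hpar ↦ ?_⟩
  have hmean : ∫ x : ℝ, g x = 0 := by
    rcases hpar with hodd | ⟨-, horth⟩
    · have h1 : ∫ x : ℝ, g (-x) = ∫ x : ℝ, g x := integral_neg_eq_self g volume
      have h2 : ∫ x : ℝ, g (-x) = -∫ x : ℝ, g x := by
        simp_rw [hodd]
        exact integral_neg g
      have h3 : ∫ x : ℝ, g x = -∫ x : ℝ, g x := h1.symm.trans h2
      linear_combination h3 / 2
    · simpa using horth
  exact weilGroundEnergy_add_le_of_integral_eq_zero hg ha ha' hsupp hnorm hmean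

end Literature.NumberTheory.LFunctions

end
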